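import Summits.Schanuel.Schanuel.Theorems.DiophantineDichotomyKhovanskiiApproxTypeEvRankThreeHardness
import Summits.Schanuel.Schanuel.Theorems.AclSubsetLogFreeCore.Negative.LogTwoBranchRelations
import Literature.Barriers.Schanuel.AlgebraicIndependenceOfLogarithms
import HarnessLib

/-!
# Route `DiophantineDichotomy`, crux `KhovanskiiApproxTypeEv`, line `anchored-reduction`:
# the two open stubs against the barrier `AlgebraicIndependenceOfLogarithms`

Crux `Summit.Schanuel.Schanuel.Theses.DiophantineDichotomy.KhovanskiiApproxTypeEv`
(item stmt-Schanuel-14972), line `anchored-reduction` (skeleton `Cruxes/KhovanskiiApproxTypeEv/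
Lines/Sketch.lean` v5; open registered stubs `stub_evNonLW_two : EvNonLWTwo`,
`stub_evRankThreeUp : EvRankThreeUp`).  The level-one race
(`Theorems/DiophantineDichotomyKhovanskiiApproxTypeEvRankThreeHardness.lean`, p124730) turns an
eventual approximation type `a < 1` at `θ = (s, e^s)` into `trdeg_ℚ ℚ(s, e^s) ≥ 2`.  Here the two
stubs are run at LOGARITHMIC free Khovanskii points (`e^{s}` algebraic, so `ℚ(s, e^s)` has the
transcendence degree of `ℚ(s)`), which places them exactly on the catalogued barrier
`Literature.Barriers.Schanuel.AlgebraicIndependenceOfLogarithms` (D-0021): "it is not even known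
whether or not there exist two elements of `L` which are algebraically independent over `ℚ`"
[cite: Roy1992, Introduction p. 22].

## Contents (all implications; nothing is credited to the summit)

* `algebraicIndependent_piI_log_two_of_evNonLWTwo : EvNonLWTwo → AlgebraicIndependent ℚ ![πi, log 2]`
  (registered sub-goal) — stub 6 proves, unconditionally, the printed OPEN consequence of the
  conjecture of algebraic independence of logarithms that the barrier file derives from
  `AlgIndepLogarithms` (`algebraicIndependent_piI_log_two_of_algIndepLogarithms`): at the free
  Khovanskii point `s = (πi, log 2)` (system `y₀ + 1 = y₁ − 2 = 0`).
* `algebraicIndependent_log_two_log_three_of_evNonLWTwo : EvNonLWTwo → AlgebraicIndependent ℚ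
  ![log 2, log 3]` — likewise at `s = (log 2, log 3)`.
* `two_le_trdeg_logs_of_evRankThreeUp : EvRankThreeUp → 2 ≤ trdeg_ℚ ℚ(log 2, log 3, 2πi)`
  (registered sub-goal) — stub 7 exhibits TWO ALGEBRAICALLY INDEPENDENT LOGARITHMS OF ALGEBRAIC
  NUMBERS among `log 2, log 3, 2πi` (Roy's open question verbatim), at the rank-3 free Khovanskii
  point `s = (log 2, log 3, 2πi)` (system `y₀ − 2 = y₁ − 3 = y₂ − 1 = 0`, exponential Jacobian
  `diag(2, 3, 1)`).
So both residual stubs of the line sit behind the barrier `AlgebraicIndependenceOfLogarithms`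
(technique class: Gel'fond–Schneider–Baker / linear subgroup theorem deliver only `ℚ̄`-LINEAR
independence of logarithms); no line evades it, which is why the lead hands both stubs back.
-/

noncomputable section

-- `Summit.Schanuel.Schanuel.…` is the mandated summit/sub-problem namespace (single-conjunct summit), hence:
set_option linter.dupNamespace false

namespace Summit.Schanuel.Schanuel.Cruxes.KhovanskiiApproxTypeEv.AnchoredReduction

open Summit.Schanuel.Schanuel.Cruxes.KhovanskiiApproxType.LwSmallHeight (IsFreeKhovanskii)
open Summit.Schanuel.Schanuel.Theorems.AclSubsetLogFreeCore.Negative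
  (exp_log_two exp_log_three linearIndependent_log_two_log_three_two_pi_I)
open Literature.Barriers.Schanuel
  (trdeg_adjoin_union_eq_of_isAlgebraic algebraicIndependent_of_le_trdeg_adjoin
    linearIndependent_piI_log_two)
open Complex

/-! ## Logarithmic points: `ℚ(s, e^s)` has the transcendence degree of `ℚ(s)` -/

/-- At a point all of whose exponentials are algebraic, `trdeg_ℚ ℚ(s, e^s) = trdeg_ℚ ℚ(s)`
(adjoining algebraic elements does not change the transcendence degree). [folklore] -/
theorem trdeg_adjoin_eq_of_exp_algebraic {n : ℕ} (s : Fin n → ℂ)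
    (halg : ∀ i, IsAlgebraic ℚ (Complex.exp (s i))) :
    Algebra.trdeg ℚ ↥(IntermediateField.adjoin ℚ (Set.range s ∪ Set.range (Complex.exp ∘ s))) =
      Algebra.trdeg ℚ ↥(IntermediateField.adjoin ℚ (Set.range s)) := by
  refine trdeg_adjoin_union_eq_of_isAlgebraic _ _ ?_
  rintro _ ⟨i, rfl⟩
  exact halg i

/-- `e^{πi} = −1`. [folklore] -/
theorem exp_pi_I : Complex.exp ((Real.pi : ℂ) * I) = -1 := Complex.exp_pi_mul_I

/-- `e^{2πi} = 1`. [folklore] -/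
theorem exp_two_pi_I : Complex.exp (2 * (Real.pi : ℂ) * I) = 1 := Complex.exp_two_pi_mul_I

/-! ## Stub 6 at the logarithmic points `(πi, log 2)` and `(log 2, log 3)` -/

/-- `s = (πi, log 2)` is a free Khovanskii point of rank `2`: a zero of the Khovanskii system
`y₀ + 1 = 0`, `y₁ − 2 = 0` whose exponential Jacobian is `diag(e^{s₀}, e^{s₁}) = diag(−1, 2)`.
[folklore] -/
theorem isFreeKhovanskii_piI_logTwo :
    IsFreeKhovanskii 2 ![(Real.pi : ℂ) * I, (Real.log 2 : ℂ)] := by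
  classical
  have hl2 : Complex.exp (Complex.log 2) = 2 := Complex.exp_log (by norm_num)
  refine ⟨![MvPolynomial.X (Sum.inr 0) + MvPolynomial.C 1,
    MvPolynomial.X (Sum.inr 1) - MvPolynomial.C 2], ?_, ?_⟩
  · intro i
    fin_cases i
    · simp
    · simp [hl2]
  · rw [Matrix.det_fin_two]
    simp [Matrix.of_apply, MvPolynomial.pderiv_X]

/-- **Registered sub-goal `algebraicIndependent_piI_log_two_of_evNonLWTwo` — stub 6 proves the
printed open consequence of the conjecture of algebraic independence of logarithms.**
`EvNonLWTwo` gives, unconditionally, that `πi = log(−1)` and `log 2` are algebraically independent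
over `ℚ` — the statement the barrier file `Literature/Barriers/Schanuel/AlgebraicIndependenceOfLogarithms.lean`
derives from the OPEN conjecture `AlgIndepLogarithms` (`algebraicIndependent_piI_log_two_of_algIndepLogarithms`)
and records as open: "it is not even known whether or not there exist two elements of `L` which
are algebraically independent over `ℚ`".  Proof: the level-one race at the free Khovanskii point
`(πi, log 2)` (`schanuelTwo_of_evNonLWTwo`), `e^{πi}, e^{log 2} ∈ ℚ̄`, and
`algebraicIndependent_of_le_trdeg_adjoin`. [cite: Roy1992, Introduction p. 22] -/
theorem algebraicIndependent_piI_log_two_of_evNonLWTwo :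
    EvNonLWTwo → AlgebraicIndependent ℚ ![(Real.pi : ℂ) * Complex.I, (Real.log 2 : ℂ)] := by
  intro hN
  set s : Fin 2 → ℂ := ![(Real.pi : ℂ) * I, (Real.log 2 : ℂ)] with hs
  have halg : ∀ i, IsAlgebraic ℚ (Complex.exp (s i)) := by
    intro i
    fin_cases i
    · simp only [hs, Fin.zero_eta, Fin.isValue, Matrix.cons_val_zero, exp_pi_I]
      simpa using isAlgebraic_algebraMap (R := ℚ) (A := ℂ) (-1)
    · simp only [hs, Fin.mk_one, Fin.isValue, Matrix.cons_val_one, Matrix.cons_val_fin_one,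
        exp_log_two]
      simpa using isAlgebraic_algebraMap (R := ℚ) (A := ℂ) 2
  have htr : ∃ i, Transcendental ℚ (s i) :=
    ⟨1, by simpa [hs] using transcendental_logTwo⟩
  have h2 := schanuelTwo_of_evNonLWTwo hN s linearIndependent_piI_log_two
    isFreeKhovanskii_piI_logTwo htr
  rw [trdeg_adjoin_eq_of_exp_algebraic s halg] at h2
  exact algebraicIndependent_of_le_trdeg_adjoin s (by exact_mod_cast h2)

/-- `log 2, log 3` are `ℚ`-linearly independent (`2^a 3^b ≠ 1`; restriction of the landed
`linearIndependent_log_two_log_three_two_pi_I`). [folklore] -/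
theorem linearIndependent_log_two_log_three :
    LinearIndependent ℚ ![(Real.log 2 : ℂ), (Real.log 3 : ℂ)] := by
  have h := linearIndependent_log_two_log_three_two_pi_I.comp (Fin.castSucc (n := 2))
    (Fin.castSucc_injective 2)
  convert h using 1
  ext i
  fin_cases i <;> rfl

/-- `s = (log 2, log 3)` is a free Khovanskii point of rank `2`: a zero of `y₀ − 2 = 0`,
`y₁ − 3 = 0` with exponential Jacobian `diag(2, 3)`. [folklore] -/
theorem isFreeKhovanskii_logTwo_logThree :
    IsFreeKhovanskii 2 ![(Real.log 2 : ℂ), (Real.log 3 : ℂ)] := by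
  classical
  have hl2 : Complex.exp (Complex.log 2) = 2 := Complex.exp_log (by norm_num)
  have hl3 : Complex.exp (Complex.log 3) = 3 := Complex.exp_log (by norm_num)
  refine ⟨![MvPolynomial.X (Sum.inr 0) - MvPolynomial.C 2,
    MvPolynomial.X (Sum.inr 1) - MvPolynomial.C 3], ?_, ?_⟩
  · intro i
    fin_cases i
    · simp [hl2]
    · simp [hl3]
  · rw [Matrix.det_fin_two]
    simp [Matrix.of_apply, MvPolynomial.pderiv_X]

/-- **Stub 6 proves `log 2 ⊥ log 3`.** `EvNonLWTwo` gives, unconditionally, the algebraic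
independence of `log 2` and `log 3` over `ℚ` (open; an instance of `AlgIndepLogarithms`): the
level-one race at the free Khovanskii point `(log 2, log 3)`. [cite: Roy1992, Introduction p. 22] -/
theorem algebraicIndependent_log_two_log_three_of_evNonLWTwo (hN : EvNonLWTwo) :
    AlgebraicIndependent ℚ ![(Real.log 2 : ℂ), (Real.log 3 : ℂ)] := by
  set s : Fin 2 → ℂ := ![(Real.log 2 : ℂ), (Real.log 3 : ℂ)] with hs
  have halg : ∀ i, IsAlgebraic ℚ (Complex.exp (s i)) := by
    intro i
    fin_cases i
    · simp only [hs, Fin.zero_eta, Fin.isValue, Matrix.cons_val_zero, exp_log_two]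
      simpa using isAlgebraic_algebraMap (R := ℚ) (A := ℂ) 2
    · simp only [hs, Fin.mk_one, Fin.isValue, Matrix.cons_val_one, Matrix.cons_val_fin_one,
        exp_log_three]
      simpa using isAlgebraic_algebraMap (R := ℚ) (A := ℂ) 3
  have htr : ∃ i, Transcendental ℚ (s i) :=
    ⟨0, by simpa [hs] using transcendental_logTwo⟩
  have h2 := schanuelTwo_of_evNonLWTwo hN s linearIndependent_log_two_log_three
    isFreeKhovanskii_logTwo_logThree htr
  rw [trdeg_adjoin_eq_of_exp_algebraic s halg] at h2
  exact algebraicIndependent_of_le_trdeg_adjoin s (by exact_mod_cast h2)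

/-! ## Stub 7 at the logarithmic point `(log 2, log 3, 2πi)` -/

/-- `s = (log 2, log 3, 2πi)` is a free Khovanskii point of rank `3`: a zero of `y₀ − 2 = 0`,
`y₁ − 3 = 0`, `y₂ − 1 = 0` with exponential Jacobian `diag(2, 3, 1)`. [folklore] -/
theorem isFreeKhovanskii_logTwo_logThree_twoPiI :
    IsFreeKhovanskii 3 ![(Real.log 2 : ℂ), (Real.log 3 : ℂ), 2 * Real.pi * I] := by
  classical
  have hl2 : Complex.exp (Complex.log 2) = 2 := Complex.exp_log (by norm_num)
  have hl3 : Complex.exp (Complex.log 3) = 3 := Complex.exp_log (by norm_num)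
  refine ⟨![MvPolynomial.X (Sum.inr 0) - MvPolynomial.C 2,
    MvPolynomial.X (Sum.inr 1) - MvPolynomial.C 3,
    MvPolynomial.X (Sum.inr 2) - MvPolynomial.C 1], ?_, ?_⟩
  · intro i
    fin_cases i
    · simp [hl2]
    · simp [hl3]
    · simp
  · rw [Matrix.det_fin_three]
    simp [Matrix.of_apply, MvPolynomial.pderiv_X]

/-- **Registered sub-goal `two_le_trdeg_logs_of_evRankThreeUp` — stub 7 exhibits two
algebraically independent logarithms of algebraic numbers.** `EvRankThreeUp` (eventual type
`a < 1/2` at the rank-3 free Khovanskii points) gives, unconditionally,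
`trdeg_ℚ ℚ(log 2, log 3, 2πi) ≥ 2`, i.e. two of the three logarithms of algebraic numbers
`log 2, log 3, 2πi = log 1` are algebraically independent over `ℚ` — precisely what Roy records as
unknown: "it is not even known whether or not there exist two elements of `L` which are
algebraically independent over `ℚ`" (barrier `AlgebraicIndependenceOfLogarithms`).  Proof: the
level-one race at `(log 2, log 3, 2πi)` (`trdeg_two_of_evRankThreeUp`) and `e^{s} = (2, 3, 1) ∈ ℚ̄³`.
[cite: Roy1992, Introduction p. 22] -/
theorem two_le_trdeg_logs_of_evRankThreeUp : EvRankThreeUp → (2 : Cardinal) ≤ Algebra.trdeg ℚ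
    ↥(IntermediateField.adjoin ℚ
      (Set.range ![(Real.log 2 : ℂ), (Real.log 3 : ℂ), 2 * Real.pi * Complex.I])) := by
  intro hR
  set s : Fin 3 → ℂ := ![(Real.log 2 : ℂ), (Real.log 3 : ℂ), 2 * Real.pi * I] with hs
  have halg : ∀ i, IsAlgebraic ℚ (Complex.exp (s i)) := by
    intro i
    fin_cases i
    · simp only [hs, Fin.zero_eta, Fin.isValue, Matrix.cons_val_zero, exp_log_two]
      simpa using isAlgebraic_algebraMap (R := ℚ) (A := ℂ) 2
    · simp only [hs, Fin.mk_one, Fin.isValue, Matrix.cons_val_one, Matrix.cons_val_zero,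
        exp_log_three]
      simpa using isAlgebraic_algebraMap (R := ℚ) (A := ℂ) 3
    · simp only [hs, Fin.reduceFinMk, Matrix.cons_val, exp_two_pi_I]
      exact isAlgebraic_one
  have h2 := trdeg_two_of_evRankThreeUp hR 3 s le_rfl linearIndependent_log_two_log_three_two_pi_I
    isFreeKhovanskii_logTwo_logThree_twoPiI
  rwa [trdeg_adjoin_eq_of_exp_algebraic s halg] at h2

end Summit.Schanuel.Schanuel.Cruxes.KhovanskiiApproxTypeEv.AnchoredReduction

end
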